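import Mathlib
import Summits.KontsevichZagierPeriods.Zeta5Search.Families.ConstantTermTypesLimit
import HarnessLib

/-!
# ζ(5) search — Families: `lim (1/n) log CT[Λⁿ] = log Λ(g*)` at a critical point `g*` (method of types, p3 g8)

HONEST FRAMING: systematic search; no irrationality claim unless certified.  Elementary real analysis; nothing in this
file mentions a zeta value and no number of record moves.

OUR work (Summit side; cell `pub-zeta5`, prover seat p3, generation 8).  Sequel of `Families/ConstantTermTypes` and
`Families/ConstantTermTypesLimit`.  Setting: `N` an `MvPolynomial` over `ℝ` with non-negative coefficients, `B` with
`coeff B N > 0`, `g` in the open orthant and CRITICAL for `Λ = N/X^B` (`Σ_k c_k g^k k_i = B_i N(g)`), and ONE positive integer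
relation among the monomials, `Σ_{k ∈ supp N} q_k • k = (Σ q_k) • B` with all `q_k ≥ 1` (for a concrete `N` a `decide`-able
certificate; it makes the defect semigroup a group).
* ROUNDING TYPES `tRound n` (`⌊n μ_k⌋` off the free index `B`, the rest on `B`): in `piAntidiag (supp N) n`, within `|supp N|` of
  `n μ` (`abs_tRound_sub_le`), with exponent `n•B + δ_n`, the DEFECT `δ_n ∈ ℤ^σ` lying in a fixed finite box (`abs_defect_le`);
* REPAIR: the first index `n₀(n) ≤ M` with the same defect gives a complementary type of bounded size `corrSize n ≤ M·Q` whose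
  exponent closes the gap: `texp (tRound n) + texp (tCorr n) = (n + corrSize n) • B` (`texp_tRound_add_tCorr`), so
  `CT[Λ^{n + corrSize n}] ≥ tweight (tRound n) · κ₀` with `κ₀ > 0` fixed (`ctPow_shift_ge`);
* ENTROPY: `(1/n)·(Σ_k t_k log(n/t_k) + Σ_k t_k log c_k) → Σ_k μ_k log(c_k/μ_k) = log Λ(g)` (`tendsto_entropy_tRound`);
* **`ctRate_eq_log_lamVal`**: `ctRate N B = log Λ(g)`, i.e. **`tendsto_log_ctPow_div_critical`**:
  `log CT[Λⁿ]/n → log Λ(g)`.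
Intended use: the `liminf` half of cert-2's CONJECTURE D (`Families/DualConstantTerm.LeadingCoeffRateIsDualDecay`) with
`N = dualSpanProd (bzNum a)`, `B = bzDen a|₆`, `g` the minimiser of `Λ_a` on the dual cell.  Standard axioms only.
-/

noncomputable section

open MvPolynomial Finset Real Filter Topology

namespace Summit.KontsevichZagierPeriods.Zeta5Search.Families.CTTypes

variable {σ : Type*} [DecidableEq σ]

/-! ## Rounding types -/

/-- The ROUNDING TYPE at level `n`: `⌊n μ_k⌋` for the monomials `k ≠ B`, the remainder on `B`, zero off the support. -/
def tRound (N : MvPolynomial σ ℝ) (B : σ →₀ ℕ) (g : σ → ℝ) (n : ℕ) (k : σ →₀ ℕ) : ℕ :=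
  if k ∈ N.support then
    (if k = B then n - ∑ k' ∈ N.support.erase B, ⌊(n : ℝ) * tilt N g k'⌋₊ else ⌊(n : ℝ) * tilt N g k⌋₊)
  else 0

omit [DecidableEq σ] in
/-- A monomial with positive coefficient is in the support. -/
theorem mem_support_of_coeff_pos {N : MvPolynomial σ ℝ} {B : σ →₀ ℕ} (hB : 0 < N.coeff B) : B ∈ N.support :=
  mem_support_iff.2 hB.ne'

section Round

variable {N : MvPolynomial σ ℝ} (hN : ∀ m, 0 ≤ N.coeff m) {B : σ →₀ ℕ} (hB : 0 < N.coeff B) {g : σ → ℝ} (hg : ∀ i, 0 < g i)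
include hN hB hg

/-- The floors off `B` sum to at most `n` (as reals: `≤ n(1 − μ_B) ≤ n`). -/
theorem sum_floor_le (n : ℕ) : ∑ k' ∈ N.support.erase B, ⌊(n : ℝ) * tilt N g k'⌋₊ ≤ n := by
  have hμB : 0 < tilt N g B := tilt_pos hN hB hg (mem_support_of_coeff_pos hB)
  have hsum : ∑ k' ∈ N.support.erase B, tilt N g k' = 1 - tilt N g B := by
    rw [← sum_tilt hN hB hg, ← Finset.sum_erase_add _ _ (mem_support_of_coeff_pos hB)]
    ring
  have h1 : ((∑ k' ∈ N.support.erase B, ⌊(n : ℝ) * tilt N g k'⌋₊ : ℕ) : ℝ) ≤ ∑ k' ∈ N.support.erase B, (n : ℝ) * tilt N g k' := by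
    push_cast
    refine Finset.sum_le_sum fun k' hk' => Nat.floor_le ?_
    exact mul_nonneg (Nat.cast_nonneg _) (tilt_pos hN hB hg (Finset.mem_of_mem_erase hk')).le
  rw [← Finset.mul_sum, hsum] at h1
  have h2 : (n : ℝ) * (1 - tilt N g B) ≤ n := by nlinarith [hμB, (Nat.cast_nonneg n : (0 : ℝ) ≤ n)]
  exact_mod_cast h1.trans h2

/-- The rounding type has size `n`. -/
theorem sum_tRound (n : ℕ) : ∑ k ∈ N.support, tRound N B g n k = n := by
  rw [← Finset.add_sum_erase _ _ (mem_support_of_coeff_pos hB)]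
  have h1 : tRound N B g n B = n - ∑ k' ∈ N.support.erase B, ⌊(n : ℝ) * tilt N g k'⌋₊ := by
    simp [tRound, mem_support_of_coeff_pos hB]
  have h2 : ∑ k ∈ N.support.erase B, tRound N B g n k = ∑ k' ∈ N.support.erase B, ⌊(n : ℝ) * tilt N g k'⌋₊ := by
    refine Finset.sum_congr rfl fun k hk => ?_
    have hkB : k ≠ B := Finset.ne_of_mem_erase hk
    simp [tRound, Finset.mem_of_mem_erase hk, hkB]
  rw [h1, h2]
  exact Nat.sub_add_cancel (sum_floor_le hN hB hg n)

/-- The rounding type is a type of size `n` on the support. -/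
theorem tRound_mem_piAntidiag (n : ℕ) : tRound N B g n ∈ N.support.piAntidiag n := by
  rw [Finset.mem_piAntidiag]
  refine ⟨sum_tRound hN hB hg n, fun k hk => ?_⟩
  by_contra h
  simp [tRound, h] at hk

/-- The rounding type is within `|supp N|` of `n μ`. -/
theorem abs_tRound_sub_le (n : ℕ) {k : σ →₀ ℕ} (hk : k ∈ N.support) :
    |(tRound N B g n k : ℝ) - n * tilt N g k| ≤ N.support.card := by
  have hcard : (1 : ℝ) ≤ N.support.card := by exact_mod_cast Finset.card_pos.2 ⟨B, mem_support_of_coeff_pos hB⟩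
  have hfl : ∀ k' ∈ N.support, |(⌊(n : ℝ) * tilt N g k'⌋₊ : ℝ) - n * tilt N g k'| ≤ 1 := by
    intro k' hk'
    have h0 : 0 ≤ (n : ℝ) * tilt N g k' := mul_nonneg (Nat.cast_nonneg _) (tilt_pos hN hB hg hk').le
    rw [abs_le]
    constructor
    · linarith [Nat.lt_floor_add_one ((n : ℝ) * tilt N g k')]
    · linarith [Nat.floor_le h0]
  by_cases hkB : k = B
  · rw [hkB] at hk ⊢
    -- `t_B − n μ_B = Σ_{k' ≠ B} (n μ_{k'} − ⌊n μ_{k'}⌋)`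
    have h1 : (tRound N B g n B : ℝ) = n - ∑ k' ∈ N.support.erase B, (⌊(n : ℝ) * tilt N g k'⌋₊ : ℝ) := by
      have : tRound N B g n B = n - ∑ k' ∈ N.support.erase B, ⌊(n : ℝ) * tilt N g k'⌋₊ := by simp [tRound, hk]
      rw [this, Nat.cast_sub (sum_floor_le hN hB hg n)]
      push_cast
      rfl
    have hμ : (n : ℝ) * tilt N g B = n - ∑ k' ∈ N.support.erase B, (n : ℝ) * tilt N g k' := by
      rw [← Finset.mul_sum]
      have := sum_tilt hN hB hg (N := N) (g := g)
      rw [← Finset.add_sum_erase _ _ hk] at this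
      nlinarith [this]
    rw [h1, hμ]
    have : ((n : ℝ) - ∑ k' ∈ N.support.erase B, (⌊(n : ℝ) * tilt N g k'⌋₊ : ℝ)) -
        (n - ∑ k' ∈ N.support.erase B, (n : ℝ) * tilt N g k') =
        ∑ k' ∈ N.support.erase B, ((n : ℝ) * tilt N g k' - ⌊(n : ℝ) * tilt N g k'⌋₊) := by
      rw [Finset.sum_sub_distrib]; ring
    rw [this]
    calc |∑ k' ∈ N.support.erase B, ((n : ℝ) * tilt N g k' - ⌊(n : ℝ) * tilt N g k'⌋₊)|
        ≤ ∑ k' ∈ N.support.erase B, |(n : ℝ) * tilt N g k' - ⌊(n : ℝ) * tilt N g k'⌋₊| :=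
          Finset.abs_sum_le_sum_abs _ _
      _ ≤ ∑ k' ∈ N.support.erase B, (1 : ℝ) := Finset.sum_le_sum fun k' hk' => by
          rw [abs_sub_comm]; exact hfl k' (Finset.mem_of_mem_erase hk')
      _ ≤ N.support.card := by
          simp only [Finset.sum_const, nsmul_eq_mul, mul_one]
          exact_mod_cast Finset.card_erase_le
  · have : (tRound N B g n k : ℝ) = ⌊(n : ℝ) * tilt N g k⌋₊ := by simp [tRound, hk, hkB]
    rw [this]
    exact (hfl k hk).trans hcard

end Round

/-! ## Exponents of types, the defect of the rounding type -/

omit [DecidableEq σ] in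
/-- Coordinates of the exponent of a type: `(texp s t) i = Σ_k t_k k_i`. -/
theorem texp_apply (s : Finset (σ →₀ ℕ)) (t : (σ →₀ ℕ) → ℕ) (i : σ) : texp s t i = ∑ k ∈ s, t k * k i := by
  unfold texp
  rw [Finsupp.finsetSum_apply]
  refine Finset.sum_congr rfl fun k _ => ?_
  rw [Finsupp.smul_apply, smul_eq_mul]

omit [DecidableEq σ] in
/-- `texp` is additive in the type (pointwise on `s`). -/
theorem texp_add_of_eq (s : Finset (σ →₀ ℕ)) {t t' u : (σ →₀ ℕ) → ℕ} (h : ∀ k ∈ s, t k + t' k = u k) :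
    texp s t + texp s t' = texp s u := by
  unfold texp
  rw [← Finset.sum_add_distrib]
  refine Finset.sum_congr rfl fun k hk => ?_
  rw [← add_smul, h k hk]

/-- The DEFECT of the rounding type: `δ_n i = (texp tRound n) i − n B_i ∈ ℤ`. -/
def defect (N : MvPolynomial σ ℝ) (B : σ →₀ ℕ) (g : σ → ℝ) (n : ℕ) (i : σ) : ℤ :=
  ((texp N.support (tRound N B g n)) i : ℤ) - (n : ℤ) * (B i : ℤ)

/-- The box bound of the defect in coordinate `i`: `|supp N| · Σ_k k_i`. -/
def defectBound (N : MvPolynomial σ ℝ) (i : σ) : ℕ := N.support.card * ∑ k ∈ N.support, k i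

section Defect

variable {N : MvPolynomial σ ℝ} (hN : ∀ m, 0 ≤ N.coeff m) {B : σ →₀ ℕ} (hB : 0 < N.coeff B) {g : σ → ℝ} (hg : ∀ i, 0 < g i)
  (hcrit : ∀ i, ∑ k ∈ N.support, N.coeff k * monoVal g k * (k i : ℝ) = (B i : ℝ) * eval g N)
include hN hB hg hcrit

/-- **The defect is bounded**: `|δ_n i| ≤ |supp N| · Σ_k k_i` (critical point: `n B_i = Σ_k n μ_k k_i`). -/
theorem abs_defect_le (n : ℕ) (i : σ) : |(defect N B g n i : ℝ)| ≤ defectBound N i := by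
  have hmean := sum_tilt_mul_eq hN hB hg hcrit i
  have h1 : (defect N B g n i : ℝ) = ∑ k ∈ N.support, ((tRound N B g n k : ℝ) - n * tilt N g k) * (k i : ℝ) := by
    have hsplit : ∑ k ∈ N.support, ((tRound N B g n k : ℝ) - n * tilt N g k) * (k i : ℝ) =
        ∑ k ∈ N.support, (tRound N B g n k : ℝ) * (k i : ℝ) - n * ∑ k ∈ N.support, tilt N g k * (k i : ℝ) := by
      rw [Finset.mul_sum, ← Finset.sum_sub_distrib]
      refine Finset.sum_congr rfl fun k _ => ?_
      ring
    rw [hsplit, hmean]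
    unfold defect
    push_cast
    rw [texp_apply]
    push_cast
    ring
  rw [h1]
  refine le_trans (Finset.abs_sum_le_sum_abs _ _) ?_
  unfold defectBound
  push_cast
  rw [Finset.mul_sum]
  refine Finset.sum_le_sum fun k hk => ?_
  rw [abs_mul, Nat.abs_cast]
  exact mul_le_mul_of_nonneg_right (abs_tRound_sub_le hN hB hg n hk) (Nat.cast_nonneg _)

/-- The defect lies in the finite box `∏_i [−R_i, R_i]`. -/
theorem defect_mem_box [Fintype σ] (n : ℕ) :
    defect N B g n ∈ Fintype.piFinset fun i => Finset.Icc (-(defectBound N i : ℤ)) (defectBound N i) := by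
  rw [Fintype.mem_piFinset]
  intro i
  rw [Finset.mem_Icc, ← abs_le]
  exact_mod_cast abs_defect_le hN hB hg hcrit n i

end Defect

/-! ## Repair: the first index with the same defect, and the complementary type -/

/-- A type of size `m` has entries `≤ m`. -/
theorem tRound_le {N : MvPolynomial σ ℝ} (hN : ∀ m, 0 ≤ N.coeff m) {B : σ →₀ ℕ} (hB : 0 < N.coeff B) {g : σ → ℝ}
    (hg : ∀ i, 0 < g i) (m : ℕ) {k : σ →₀ ℕ} (hk : k ∈ N.support) : tRound N B g m k ≤ m := by
  have h := Finset.single_le_sum (f := fun k => tRound N B g m k) (fun k _ => Nat.zero_le _) hk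
  rw [sum_tRound hN hB hg m] at h
  exact h


/-- The first index `n₀ ≤ n` whose rounding type has the same defect as `n`. -/
def firstIdx [Fintype σ] (N : MvPolynomial σ ℝ) (B : σ →₀ ℕ) (g : σ → ℝ) (n : ℕ) : ℕ :=
  Nat.find (⟨n, rfl⟩ : ∃ m, defect N B g m = defect N B g n)

/-- `δ_{n₀(n)} = δ_n`. -/
theorem defect_firstIdx [Fintype σ] (N : MvPolynomial σ ℝ) (B : σ →₀ ℕ) (g : σ → ℝ) (n : ℕ) :
    defect N B g (firstIdx N B g n) = defect N B g n :=
  Nat.find_spec (⟨n, rfl⟩ : ∃ m, defect N B g m = defect N B g n)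

/-- A bound for all first indices: the largest first index over the finite defect box. -/
def idxBound [Fintype σ] (N : MvPolynomial σ ℝ) (B : σ →₀ ℕ) (g : σ → ℝ) : ℕ :=
  (Fintype.piFinset fun i => Finset.Icc (-(defectBound N i : ℤ)) (defectBound N i)).sup
    fun d => @dite _ (∃ m, defect N B g m = d) (Classical.dec _) (fun h => Nat.find h) (fun _ => 0)

/-- **First indices are bounded** (the defects live in a finite box). -/
theorem firstIdx_le_idxBound [Fintype σ] {N : MvPolynomial σ ℝ} (hN : ∀ m, 0 ≤ N.coeff m) {B : σ →₀ ℕ} (hB : 0 < N.coeff B)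
    {g : σ → ℝ} (hg : ∀ i, 0 < g i)
    (hcrit : ∀ i, ∑ k ∈ N.support, N.coeff k * monoVal g k * (k i : ℝ) = (B i : ℝ) * eval g N) (n : ℕ) :
    firstIdx N B g n ≤ idxBound N B g := by
  have hmem := defect_mem_box hN hB hg hcrit n
  have h := Finset.le_sup
    (f := fun d => @dite _ (∃ m, defect N B g m = d) (Classical.dec _) (fun h => Nat.find h) (fun _ => 0)) hmem
  have hex : ∃ m, defect N B g m = defect N B g n := ⟨n, rfl⟩
  have hval : firstIdx N B g n ≤
      @dite _ (∃ m, defect N B g m = defect N B g n) (Classical.dec _) (fun h => Nat.find h) (fun _ => 0) := by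
    rw [dif_pos hex]
    exact Nat.find_min' _ (Nat.find_spec hex)
  exact hval.trans h

/-- The COMPLEMENTARY type repairing the defect of `n`: `n₀ q_k − tRound n₀ k` (`n₀ = firstIdx n`). -/
def tCorr [Fintype σ] (N : MvPolynomial σ ℝ) (B : σ →₀ ℕ) (g : σ → ℝ) (q : (σ →₀ ℕ) → ℕ) (n : ℕ) (k : σ →₀ ℕ) : ℕ :=
  if k ∈ N.support then firstIdx N B g n * q k - tRound N B g (firstIdx N B g n) k else 0

/-- The size of the complementary type. -/
def corrSize [Fintype σ] (N : MvPolynomial σ ℝ) (B : σ →₀ ℕ) (g : σ → ℝ) (q : (σ →₀ ℕ) → ℕ) (n : ℕ) : ℕ :=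
  ∑ k ∈ N.support, tCorr N B g q n k

section Repair

variable [Fintype σ] {N : MvPolynomial σ ℝ} (hN : ∀ m, 0 ≤ N.coeff m) {B : σ →₀ ℕ} (hB : 0 < N.coeff B) {g : σ → ℝ}
  (hg : ∀ i, 0 < g i)
  {q : (σ →₀ ℕ) → ℕ} (hq1 : ∀ k ∈ N.support, 1 ≤ q k)
  (hqrel : ∑ k ∈ N.support, q k • k = (∑ k ∈ N.support, q k) • B)
include hN hB hg

include hq1 in
/-- `tCorr n k + tRound n₀ k = n₀ q_k` on the support. -/
theorem tCorr_add_tRound (n : ℕ) {k : σ →₀ ℕ} (hk : k ∈ N.support) :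
    tCorr N B g q n k + tRound N B g (firstIdx N B g n) k = firstIdx N B g n * q k := by
  have h1 : tRound N B g (firstIdx N B g n) k ≤ firstIdx N B g n * q k :=
    le_trans (tRound_le hN hB hg _ hk) (Nat.le_mul_of_pos_right _ (hq1 k hk))
  simp only [tCorr, hk, if_true]
  omega

include hq1 in
/-- `corrSize n + n₀ = n₀ · Q`, `Q = Σ q_k`. -/
theorem corrSize_add (n : ℕ) :
    corrSize N B g q n + firstIdx N B g n = firstIdx N B g n * ∑ k ∈ N.support, q k := by
  unfold corrSize
  have hs := sum_tRound hN hB hg (firstIdx N B g n)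
  calc ∑ k ∈ N.support, tCorr N B g q n k + firstIdx N B g n
      = ∑ k ∈ N.support, tCorr N B g q n k + ∑ k ∈ N.support, tRound N B g (firstIdx N B g n) k := by rw [hs]
    _ = ∑ k ∈ N.support, (tCorr N B g q n k + tRound N B g (firstIdx N B g n) k) := by rw [Finset.sum_add_distrib]
    _ = ∑ k ∈ N.support, firstIdx N B g n * q k := Finset.sum_congr rfl fun k hk => tCorr_add_tRound hN hB hg hq1 n hk
    _ = firstIdx N B g n * ∑ k ∈ N.support, q k := by rw [Finset.mul_sum]

omit hN hB hg in
/-- The complementary type is a type of size `corrSize n` on the support. -/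
theorem tCorr_mem_piAntidiag (n : ℕ) : tCorr N B g q n ∈ N.support.piAntidiag (corrSize N B g q n) := by
  rw [Finset.mem_piAntidiag]
  refine ⟨rfl, fun k hk => ?_⟩
  by_contra h
  simp [tCorr, h] at hk

include hq1 hqrel in
/-- `texp tCorr + texp (tRound n₀) = (n₀ Q) • B`. -/
theorem texp_tCorr_add (n : ℕ) :
    texp N.support (tCorr N B g q n) + texp N.support (tRound N B g (firstIdx N B g n)) =
      (firstIdx N B g n * ∑ k ∈ N.support, q k) • B := by
  rw [texp_add_of_eq N.support (u := fun k => firstIdx N B g n * q k) (fun k hk => tCorr_add_tRound hN hB hg hq1 n hk)]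
  unfold texp
  rw [mul_smul, ← hqrel, Finset.smul_sum]
  refine Finset.sum_congr rfl fun k _ => ?_
  rw [mul_smul]

include hq1 hqrel in
/-- **The repaired exponent**: `texp (tRound n) + texp (tCorr n) = (n + corrSize n) • B`. -/
theorem texp_tRound_add_tCorr (n : ℕ) :
    texp N.support (tRound N B g n) + texp N.support (tCorr N B g q n) = (n + corrSize N B g q n) • B := by
  ext i
  have e1 : ((texp N.support (tRound N B g n)) i : ℤ) = n * B i + defect N B g n i := by
    unfold defect; ring
  have e2 : ((texp N.support (tRound N B g (firstIdx N B g n))) i : ℤ) =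
      (firstIdx N B g n : ℤ) * B i + defect N B g (firstIdx N B g n) i := by
    unfold defect; ring
  have e3 : defect N B g (firstIdx N B g n) i = defect N B g n i := by rw [defect_firstIdx]
  have e4 : ((texp N.support (tCorr N B g q n)) i : ℤ) + (texp N.support (tRound N B g (firstIdx N B g n))) i =
      (firstIdx N B g n : ℤ) * (∑ k ∈ N.support, q k : ℕ) * B i := by
    have := congrArg (fun f : σ →₀ ℕ => (f i : ℤ)) (texp_tCorr_add hN hB hg hq1 hqrel n)
    simpa [Finsupp.add_apply, Finsupp.smul_apply, mul_assoc] using this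
  have e5 : (corrSize N B g q n : ℤ) + firstIdx N B g n = (firstIdx N B g n : ℤ) * (∑ k ∈ N.support, q k : ℕ) := by
    exact_mod_cast corrSize_add hN hB hg hq1 n
  have goal : ((texp N.support (tRound N B g n)) i : ℤ) + (texp N.support (tCorr N B g q n)) i =
      ((n : ℤ) + corrSize N B g q n) * B i := by
    linear_combination e1 + e4 - e2 - (B i : ℤ) * e5 - e3
  have : (((texp N.support (tRound N B g n) + texp N.support (tCorr N B g q n)) i : ℕ) : ℤ) =
      ((((n + corrSize N B g q n) • B) i : ℕ) : ℤ) := by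
    push_cast [Finsupp.add_apply, Finsupp.smul_apply, smul_eq_mul]
    exact goal
  exact_mod_cast this

/-- The uniform positive lower bound for the weight of the complementary types. -/
def corrWeightLB (N : MvPolynomial σ ℝ) (B : σ →₀ ℕ) (g : σ → ℝ) (q : (σ →₀ ℕ) → ℕ) : ℝ :=
  ∏ k ∈ N.support, (min (N.coeff k) 1) ^ (idxBound N B g * q k)

omit hB hg in
/-- `corrWeightLB > 0`. -/
theorem corrWeightLB_pos : 0 < corrWeightLB N B g q := by
  unfold corrWeightLB
  refine Finset.prod_pos fun k hk => pow_pos (lt_min ?_ one_pos) _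
  exact lt_of_le_of_ne (hN k) (fun h => (mem_support_iff.1 hk) h.symm)

/-- **The complementary weight is uniformly bounded below**: `corrWeightLB ≤ tweight (tCorr n)`. -/
theorem corrWeightLB_le_tweight
    (hcrit : ∀ i, ∑ k ∈ N.support, N.coeff k * monoVal g k * (k i : ℝ) = (B i : ℝ) * eval g N) (n : ℕ) :
    corrWeightLB N B g q ≤ tweight N N.support (tCorr N B g q n) := by
  unfold corrWeightLB tweight
  have hM := firstIdx_le_idxBound hN hB hg hcrit n
  have h1 : (1 : ℝ) ≤ (Nat.multinomial N.support (tCorr N B g q n) : ℝ) := by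
    exact_mod_cast Nat.multinomial_pos _ _
  have h2 : ∏ k ∈ N.support, (min (N.coeff k) 1) ^ (idxBound N B g * q k) ≤
      ∏ k ∈ N.support, N.coeff k ^ tCorr N B g q n k := by
    refine Finset.prod_le_prod (fun k _ => pow_nonneg (le_min (hN k) zero_le_one) _) fun k hk => ?_
    have hc : 0 ≤ min (N.coeff k) 1 := le_min (hN k) zero_le_one
    have hle : tCorr N B g q n k ≤ idxBound N B g * q k := by
      have : tCorr N B g q n k ≤ firstIdx N B g n * q k := by simp only [tCorr, hk, if_true]; omega
      exact le_trans this (Nat.mul_le_mul_right _ hM)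
    calc (min (N.coeff k) 1) ^ (idxBound N B g * q k) ≤ (min (N.coeff k) 1) ^ tCorr N B g q n k :=
          pow_le_pow_of_le_one hc (min_le_right _ _) hle
      _ ≤ N.coeff k ^ tCorr N B g q n k := pow_le_pow_left₀ hc (min_le_left _ _) _
  have h3 : 0 ≤ ∏ k ∈ N.support, (min (N.coeff k) 1) ^ (idxBound N B g * q k) :=
    Finset.prod_nonneg fun k _ => pow_nonneg (le_min (hN k) zero_le_one) _
  nlinarith

include hq1 hqrel in
/-- **The shifted constant term dominates the rounding type**: `tweight (tRound n) · κ₀ ≤ CT[Λ^{n + corrSize n}]`. -/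
theorem ctPow_shift_ge
    (hcrit : ∀ i, ∑ k ∈ N.support, N.coeff k * monoVal g k * (k i : ℝ) = (B i : ℝ) * eval g N) (n : ℕ) :
    tweight N N.support (tRound N B g n) * corrWeightLB N B g q ≤ ctPow N B (n + corrSize N B g q n) := by
  have h1 := tweight_le_coeff_pow hN (tRound_mem_piAntidiag hN hB hg n)
  have h2 := tweight_le_coeff_pow hN (tCorr_mem_piAntidiag (N := N) (B := B) (g := g) (q := q) n)
  have h3 := coeff_pow_supermul hN n (corrSize N B g q n) (texp N.support (tRound N B g n)) (texp N.support (tCorr N B g q n))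
  rw [texp_tRound_add_tCorr hN hB hg hq1 hqrel n] at h3
  unfold ctPow
  calc tweight N N.support (tRound N B g n) * corrWeightLB N B g q
      ≤ (N ^ n).coeff (texp N.support (tRound N B g n)) * (N ^ corrSize N B g q n).coeff (texp N.support (tCorr N B g q n)) :=
        mul_le_mul h1 (le_trans (corrWeightLB_le_tweight hN hB hg hcrit n) h2) (corrWeightLB_pos hN).le
          (le_trans (tweight_nonneg hN _ _) h1)
    _ ≤ (N ^ (n + corrSize N B g q n)).coeff ((n + corrSize N B g q n) • B) := h3

include hq1 in
/-- `corrSize n ≤ idxBound · Q` — the repair blocks have bounded size. -/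
theorem corrSize_le
    (hcrit : ∀ i, ∑ k ∈ N.support, N.coeff k * monoVal g k * (k i : ℝ) = (B i : ℝ) * eval g N) (n : ℕ) :
    corrSize N B g q n ≤ idxBound N B g * ∑ k ∈ N.support, q k := by
  have h := corrSize_add hN hB hg hq1 n
  have hM := firstIdx_le_idxBound hN hB hg hcrit n
  have : firstIdx N B g n * ∑ k ∈ N.support, q k ≤ idxBound N B g * ∑ k ∈ N.support, q k := Nat.mul_le_mul_right _ hM
  omega

end Repair

end Summit.KontsevichZagierPeriods.Zeta5Search.Families.CTTypes
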